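import Summits.AtomisticToContinuum.Crystallization.Theorems.ChargedEnergyGapSecondShellLabelled
import Summits.AtomisticToContinuum.Crystallization.Theorems.ChargedEnergyGapResidualSF
import HarnessLib

/-!
# Charged energy gap — lens-3 g64, node «BarlowRef» (R3) — part 5 (addendum, INDEPENDENT of parts 1–4): the BRICK-CELL lower count of a Barlow image

Imports only the tree (`…SecondShellLabelled` for `barlowPos_triple_injective`, `…ResidualSF` ⊇ `…SeparatedCounting` for `card_le_of_separated`; `IsBarlowImage`).  ELEMENTARY·PROVED:
the DENSITY LOWER BOUND feeding the ratio target `TubeShareBound` of part 3 (§R10) — the number of sites of a Barlow image in a ball.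

* `brick a h s k i j` — the half-open axis-parallel box `barlowPos k i j + [0,a) × [0,a√3/2) × [0,h)` (a BRICK-WALL fundamental cell: row `j` of
  layer `k` is shifted by `a/2`, so axis-parallel boxes tile each layer; no parallelepipeds, no determinants); `volume_brick_le` (`≤ a·(a√3/2)·h`);
* `layerOf / colOf / rowOf` + ★ `mem_brick_of` — EVERY point of space lies in the brick of its index (floor arithmetic in the sheared coordinates),
  `dist_sq_le_of_mem_brick` (`dist² ≤ a² + 3a²/4 + h²`, the box diagonal);
* `exists_index_finset` (the sites within `R` of any point form a finite index set — packing, via the tree's `card_le_of_separated`),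
  ★ `closedBall_subset_biUnion_brick` (`B̄(q₀, R − D) ⊆ ⋃ bricks of the sites in B̄(q₀, R)`, `D² ≥ a² + 3a²/4 + h²`),
  ★★ `ball_volume_le_card_mul` (`(4π/3)(R − D)³ ≤ #sites · a(a√3/2)h` — Lebesgue measure is subadditive; NO disjointness needed);
* ★★ `IsBarlowImage.exists_finset_closedBall` — in the image window: `(4π/3)(R − 9/5)³ ≤ 1.036 · #(S ∩ B̄(q,R))` for `q ∈ S`, `R ≥ 9/5`
  (`a² + 3a²/4 + h² ≤ 1.21·(7/4 + 121/150) < 3.24 = (9/5)²`; cell volume `(√3/2)a²h ≤ 1.036`, i.e. density `≥ 0.965`);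
* RECORD COUNTS `barlow_ball_count_18 : … 17000 ≤ T.card`, `barlow_ball_count_19 : … 20000 ≤ T.card` — literally the shape of part 3's
  `BarlowBallCount 18 17000` / `BarlowBallCount 19 20000` (true minimum over the window ≈ 20 768 at `R = 18`: certification loss `0.82`).

0 sorry; standard axioms.
-/

noncomputable section

open scoped Classical
open MeasureTheory
open Literature.MathematicalPhysics.StatisticalMechanics Literature.Geometry.DiscreteGeometry
open Summit.AtomisticToContinuum.Crystallization.Theses.PricedLinkCensus
open Summit.AtomisticToContinuum.Crystallization.Theorems.ChargedEnergyGapNegative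

namespace Summit.AtomisticToContinuum.Crystallization.Theorems.ChargedEnergyGapChartDial

section CellCount

variable (a h : ℝ) (s : ℤ → ℤ)

/-- The side lengths of a brick: `a`, `a√3/2`, `h`. -/
def brickSides : Fin 3 → ℝ := ![a, a * √3 / 2, h]

/-- `brickSides_zero` (docstring added by the landing lane; see the module docstring). [formal bookkeeping] -/
@[simp] theorem brickSides_zero : brickSides a h 0 = a := rfl
/-- `brickSides_one` (docstring added by the landing lane; see the module docstring). [formal bookkeeping] -/
@[simp] theorem brickSides_one : brickSides a h 1 = a * √3 / 2 := rfl
/-- `brickSides_two` (docstring added by the landing lane; see the module docstring). [formal bookkeeping] -/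
@[simp] theorem brickSides_two : brickSides a h 2 = h := rfl

/-- The BRICK cell of site `(k,i,j)`: the half-open axis-parallel box `barlowPos k i j + [0,a) × [0,a√3/2) × [0,h)`. -/
def brick (k i j : ℤ) : Set E3 :=
  {x | ∀ m : Fin 3, barlowPos a h s k i j m ≤ x m ∧ x m < barlowPos a h s k i j m + brickSides a h m}

/-- Volume of a coordinate box in `E3` (as in the tree's `volume_coordBox`, restated to keep this part's imports minimal). -/
theorem volume_coordBox' (lo hi : Fin 3 → ℝ) :
    volume {q : E3 | WithLp.ofLp q ∈ Set.Icc lo hi} = ∏ m, ENNReal.ofReal (hi m - lo m) := by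
  rw [← Real.volume_Icc_pi]
  exact (PiLp.volume_preserving_ofLp (Fin 3)).measure_preimage measurableSet_Icc.nullMeasurableSet

/-- A brick sits inside the closed coordinate box with the same corner and sides. -/
theorem brick_subset_coordBox (k i j : ℤ) :
    brick a h s k i j ⊆ {q : E3 | WithLp.ofLp q ∈
      Set.Icc (WithLp.ofLp (barlowPos a h s k i j)) (WithLp.ofLp (barlowPos a h s k i j) + brickSides a h)} := by
  intro x hx
  simp only [Set.mem_setOf_eq, Set.mem_Icc]
  refine ⟨fun m => (hx m).1, fun m => ?_⟩
  simp only [Pi.add_apply]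
  exact (hx m).2.le

/-- ★ `volume (brick) ≤ a · (a√3/2) · h` (`a ≥ 0`). -/
theorem volume_brick_le (ha : 0 ≤ a) (k i j : ℤ) :
    volume (brick a h s k i j) ≤ ENNReal.ofReal (a * (a * √3 / 2) * h) := by
  refine (measure_mono (brick_subset_coordBox a h s k i j)).trans ?_
  rw [volume_coordBox', Fin.prod_univ_three]
  simp only [Pi.add_apply, add_sub_cancel_left, brickSides_zero, brickSides_one, brickSides_two]
  have h1 : 0 ≤ a * √3 / 2 := by positivity
  rw [← ENNReal.ofReal_mul ha, ← ENNReal.ofReal_mul (mul_nonneg ha h1)]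

/-- The layer index of a point: `⌊x₂ / h⌋`. -/
def layerOf (x : E3) : ℤ := ⌊x 2 / h⌋

/-- The column index of a point: `⌊x₁/(a√3/2) − L/3⌋`, `L` the letter of its layer. -/
def colOf (x : E3) : ℤ := ⌊x 1 / (a * √3 / 2) - (haggLabel s (layerOf h x) : ℝ) / 3⌋

/-- The row index of a point: `⌊x₀/a − j/2 − L/2⌋`. -/
def rowOf (x : E3) : ℤ := ⌊x 0 / a - (colOf a h s x : ℝ) / 2 - (haggLabel s (layerOf h x) : ℝ) / 2⌋

/-- ★ EVERY point of space lies in the brick of its index. -/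
theorem mem_brick_of (ha : 0 < a) (hh : 0 < h) (x : E3) : x ∈ brick a h s (layerOf h x) (rowOf a h s x) (colOf a h s x) := by
  have hc : 0 < a * √3 / 2 := by positivity
  set k := layerOf h x with hk
  set j := colOf a h s x with hj
  set i := rowOf a h s x with hi
  have hk1 : (k : ℝ) ≤ x 2 / h := Int.floor_le _
  have hk2 : x 2 / h < k + 1 := Int.lt_floor_add_one _
  have hj1 : (j : ℝ) ≤ x 1 / (a * √3 / 2) - (haggLabel s k : ℝ) / 3 := Int.floor_le _
  have hj2 : x 1 / (a * √3 / 2) - (haggLabel s k : ℝ) / 3 < j + 1 := Int.lt_floor_add_one _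
  have hi1 : (i : ℝ) ≤ x 0 / a - (j : ℝ) / 2 - (haggLabel s k : ℝ) / 2 := Int.floor_le _
  have hi2 : x 0 / a - (j : ℝ) / 2 - (haggLabel s k : ℝ) / 2 < i + 1 := Int.lt_floor_add_one _
  intro m
  fin_cases m
  · show barlowPos a h s k i j 0 ≤ x 0 ∧ x 0 < barlowPos a h s k i j 0 + a
    rw [barlowPos_apply_zero]
    constructor
    · have h0 : ((i : ℝ) + (j : ℝ) / 2 + (haggLabel s k : ℝ) / 2) * a ≤ x 0 := (le_div_iff₀ ha).1 (by linarith)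
      linarith
    · have h0 : x 0 < ((i : ℝ) + 1 + (j : ℝ) / 2 + (haggLabel s k : ℝ) / 2) * a := (div_lt_iff₀ ha).1 (by linarith)
      linarith
  · show barlowPos a h s k i j 1 ≤ x 1 ∧ x 1 < barlowPos a h s k i j 1 + a * √3 / 2
    rw [barlowPos_apply_one]
    constructor
    · have h0 : ((j : ℝ) + (haggLabel s k : ℝ) / 3) * (a * √3 / 2) ≤ x 1 := (le_div_iff₀ hc).1 (by linarith)
      linarith
    · have h0 : x 1 < ((j : ℝ) + 1 + (haggLabel s k : ℝ) / 3) * (a * √3 / 2) := (div_lt_iff₀ hc).1 (by linarith)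
      linarith
  · show barlowPos a h s k i j 2 ≤ x 2 ∧ x 2 < barlowPos a h s k i j 2 + h
    rw [barlowPos_apply_two]
    constructor
    · exact (le_div_iff₀ hh).1 hk1
    · have h0 : x 2 < ((k : ℝ) + 1) * h := (div_lt_iff₀ hh).1 hk2
      linarith

/-- The box diagonal: a point of a brick is within `√(a² + 3a²/4 + h²)` of its corner site. -/
theorem dist_sq_le_of_mem_brick {k i j : ℤ} {x : E3} (hx : x ∈ brick a h s k i j) :
    dist x (barlowPos a h s k i j) ^ 2 ≤ a ^ 2 + 3 * a ^ 2 / 4 + h ^ 2 := by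
  have h3 : (√3 : ℝ) ^ 2 = 3 := Real.sq_sqrt (by norm_num)
  rw [EuclideanSpace.dist_eq, Real.sq_sqrt (Finset.sum_nonneg fun _ _ => sq_nonneg _), Fin.sum_univ_three]
  have hb : ∀ m : Fin 3, dist (x m) (barlowPos a h s k i j m) ^ 2 ≤ brickSides a h m ^ 2 := by
    intro m
    have h1 := (hx m).1
    have h2 := (hx m).2
    rw [Real.dist_eq, abs_of_nonneg (by linarith)]
    exact pow_le_pow_left₀ (by linarith) (by linarith) 2
  have e0 := hb 0
  have e1 := hb 1
  have e2 := hb 2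
  simp only [brickSides_zero, brickSides_one, brickSides_two] at e0 e1 e2
  have : (a * √3 / 2) ^ 2 = 3 * a ^ 2 / 4 := by rw [show (a * √3 / 2) ^ 2 = a ^ 2 * (√3 ^ 2) / 4 by ring, h3]; ring
  rw [this] at e1
  linarith

/-- A point of a brick is within `D` of its corner site whenever `D² ≥ a² + 3a²/4 + h²`, `D ≥ 0`. -/
theorem dist_le_of_mem_brick {D : ℝ} (hD0 : 0 ≤ D) (hD : a ^ 2 + 3 * a ^ 2 / 4 + h ^ 2 ≤ D ^ 2)
    {k i j : ℤ} {x : E3} (hx : x ∈ brick a h s k i j) : dist x (barlowPos a h s k i j) ≤ D :=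
  (pow_le_pow_iff_left₀ dist_nonneg hD0 two_ne_zero).1 ((dist_sq_le_of_mem_brick a h s hx).trans hD)

/-- The sites within `R` of any point form a FINITE index set (packing: the stacking is `min a h`-separated). -/
theorem exists_index_finset (ha : 0 < a) (hh : 0 < h) (q₀ : E3) (R : ℝ) :
    ∃ I : Finset (ℤ × ℤ × ℤ), ∀ t, t ∈ I ↔ dist (barlowPos a h s t.1 t.2.1 t.2.2) q₀ ≤ R := by
  set A : Set (ℤ × ℤ × ℤ) := {t | dist (barlowPos a h s t.1 t.2.1 t.2.2) q₀ ≤ R} with hA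
  suffices hfin : A.Finite by exact ⟨hfin.toFinset, fun t => by rw [Set.Finite.mem_toFinset]; rfl⟩
  rcases lt_or_ge R 0 with hR | hR
  · have : A = ∅ := by
      ext t
      simp only [hA, Set.mem_setOf_eq, Set.mem_empty_iff_false, iff_false, not_le]
      exact hR.trans_le dist_nonneg
    rw [this]; exact Set.finite_empty
  by_contra hinf
  have hinf' : A.Infinite := hinf
  set m : ℝ := min a h with hm
  have hm0 : 0 < m := lt_min ha hh
  set N : ℕ := ⌊((2 * R + m) / m) ^ 3⌋₊ + 1 with hN
  obtain ⟨T, hTA, hcard⟩ := hinf'.exists_subset_card_eq N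
  let bp : ℤ × ℤ × ℤ → E3 := fun t => barlowPos a h s t.1 t.2.1 t.2.2
  have hinj : Function.Injective bp := barlowPos_triple_injective ha hh
  set T' : Finset E3 := T.image bp with hT'
  have hcard' : T'.card = N := by rw [hT', Finset.card_image_of_injective _ hinj, hcard]
  have hsep : ∀ p ∈ T', ∀ q ∈ T', p ≠ q → m ≤ dist p q := by
    intro p hp q hq hpq
    obtain ⟨t, -, rfl⟩ := Finset.mem_image.1 hp
    obtain ⟨t', -, rfl⟩ := Finset.mem_image.1 hq
    have hne : (t.1, t.2.1, t.2.2) ≠ (t'.1, t'.2.1, t'.2.2) := by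
      intro heq; apply hpq
      have : t = t' := by
        rcases t with ⟨t1, t2, t3⟩; rcases t' with ⟨t1', t2', t3'⟩
        simp only [Prod.mk.injEq] at heq ⊢; exact heq
      rw [this]
    exact le_dist_barlowPos a h s ha.le hh.le hne
  have hin : ∀ p ∈ T', dist p q₀ ≤ R := by
    intro p hp
    obtain ⟨t, ht, rfl⟩ := Finset.mem_image.1 hp
    exact hTA (Finset.mem_coe.2 ht)
  have hle := card_le_of_separated T' hm0 hR q₀ hsep hin
  rw [hcard'] at hle
  have hlt : ((2 * R + m) / m) ^ 3 < (N : ℝ) := by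
    rw [hN]; push_cast; exact Nat.lt_floor_add_one _
  linarith

/-- ★ COVERING: `B̄(q₀, R − D) ⊆ ⋃ {brick t : t a site with dist(t, q₀) ≤ R}` (`D² ≥ a² + 3a²/4 + h²`). -/
theorem closedBall_subset_biUnion_brick (ha : 0 < a) (hh : 0 < h) {D : ℝ} (hD0 : 0 ≤ D)
    (hD : a ^ 2 + 3 * a ^ 2 / 4 + h ^ 2 ≤ D ^ 2) (q₀ : E3) (R : ℝ) (I : Finset (ℤ × ℤ × ℤ))
    (hI : ∀ t : ℤ × ℤ × ℤ, dist (barlowPos a h s t.1 t.2.1 t.2.2) q₀ ≤ R → t ∈ I) :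
    Metric.closedBall q₀ (R - D) ⊆ ⋃ t ∈ I, brick a h s t.1 t.2.1 t.2.2 := by
  intro x hx
  rw [Metric.mem_closedBall] at hx
  set t : ℤ × ℤ × ℤ := (layerOf h x, rowOf a h s x, colOf a h s x) with ht
  have hmem : x ∈ brick a h s t.1 t.2.1 t.2.2 := mem_brick_of a h s ha hh x
  have hd : dist x (barlowPos a h s t.1 t.2.1 t.2.2) ≤ D := dist_le_of_mem_brick a h s hD0 hD hmem
  have htI : t ∈ I := by
    refine hI t ?_
    calc dist (barlowPos a h s t.1 t.2.1 t.2.2) q₀ ≤ dist (barlowPos a h s t.1 t.2.1 t.2.2) x + dist x q₀ := dist_triangle _ _ _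
      _ ≤ D + (R - D) := add_le_add (by rwa [dist_comm]) hx
      _ = R := by ring
  exact Set.mem_iUnion₂.2 ⟨t, htI, hmem⟩

/-- ★★ VOLUME COUNT: `(4π/3)(R − D)³ ≤ #I · a(a√3/2)h` for any finite index set `I` containing every site within `R` of `q₀`
(`D ≤ R`, `D² ≥ a² + 3a²/4 + h²`).  Subadditivity of Lebesgue measure only — the bricks need not be disjoint. -/
theorem ball_volume_le_card_mul (ha : 0 < a) (hh : 0 < h) {D : ℝ} (hD0 : 0 ≤ D)
    (hD : a ^ 2 + 3 * a ^ 2 / 4 + h ^ 2 ≤ D ^ 2) (q₀ : E3) {R : ℝ} (hRD : D ≤ R) (I : Finset (ℤ × ℤ × ℤ))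
    (hI : ∀ t : ℤ × ℤ × ℤ, dist (barlowPos a h s t.1 t.2.1 t.2.2) q₀ ≤ R → t ∈ I) :
    4 * Real.pi / 3 * (R - D) ^ 3 ≤ (I.card : ℝ) * (a * (a * √3 / 2) * h) := by
  have hV0 : 0 ≤ a * (a * √3 / 2) * h := by positivity
  have hsub := closedBall_subset_biUnion_brick a h s ha hh hD0 hD q₀ R I hI
  have h1 : volume (Metric.closedBall q₀ (R - D)) ≤ ∑ t ∈ I, volume (brick a h s t.1 t.2.1 t.2.2) :=
    (measure_mono hsub).trans (measure_biUnion_finset_le I _)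
  have h2 : ∑ t ∈ I, volume (brick a h s t.1 t.2.1 t.2.2) ≤ ∑ _t ∈ I, ENNReal.ofReal (a * (a * √3 / 2) * h) :=
    Finset.sum_le_sum fun t _ => volume_brick_le a h s ha.le t.1 t.2.1 t.2.2
  rw [Finset.sum_const, nsmul_eq_mul, EuclideanSpace.volume_closedBall_fin_three] at *
  have h3 := h1.trans h2
  rw [← ENNReal.ofReal_pow (by linarith), ← ENNReal.ofReal_mul (by positivity), ← ENNReal.ofReal_natCast,
    ← ENNReal.ofReal_mul (Nat.cast_nonneg _), ENNReal.ofReal_le_ofReal_iff (mul_nonneg (Nat.cast_nonneg _) hV0)] at h3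
  linarith

/-- WINDOW ARITHMETIC (i): the brick diagonal is `≤ 9/5` (`a ≤ 11/10`, `h² ≤ 121a²/150`). -/
theorem window_brick_diag {a h : ℝ} (ha : 9 / 10 ≤ a ∧ a ≤ 11 / 10) (hh : 0 < h ∧ 27 / 50 * a ^ 2 ≤ h ^ 2 ∧ h ^ 2 ≤ 121 / 150 * a ^ 2) :
    a ^ 2 + 3 * a ^ 2 / 4 + h ^ 2 ≤ (9 / 5 : ℝ) ^ 2 := by
  have ha2 : a ^ 2 ≤ 121 / 100 := by nlinarith [ha.1, ha.2]
  nlinarith [hh.2.2]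

/-- WINDOW ARITHMETIC (ii): the cell volume is `≤ 1.036` (density `≥ 0.965`). -/
theorem window_cell_volume {a h : ℝ} (ha : 9 / 10 ≤ a ∧ a ≤ 11 / 10) (hh : 0 < h ∧ 27 / 50 * a ^ 2 ≤ h ^ 2 ∧ h ^ 2 ≤ 121 / 150 * a ^ 2) :
    a * (a * √3 / 2) * h ≤ 1036 / 1000 := by
  have h3 : (√3 : ℝ) ^ 2 = 3 := Real.sq_sqrt (by norm_num)
  have ha0 : 0 ≤ a := by linarith [ha.1]
  have hV0 : 0 ≤ a * (a * √3 / 2) * h := by have := hh.1.le; positivity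
  have ha2 : a ^ 2 ≤ 121 / 100 := by nlinarith [ha.1, ha.2]
  have ha4 : a ^ 4 ≤ (121 / 100) ^ 2 := by nlinarith
  have ha6 : a ^ 4 * h ^ 2 ≤ (121 / 100) ^ 2 * (121 / 150 * (121 / 100)) := by
    have hh2 : h ^ 2 ≤ 121 / 150 * (121 / 100) := by nlinarith [hh.2.2]
    exact mul_le_mul ha4 hh2 (sq_nonneg _) (by positivity)
  have hsq : (a * (a * √3 / 2) * h) ^ 2 ≤ (1036 / 1000 : ℝ) ^ 2 := by
    rw [show (a * (a * √3 / 2) * h) ^ 2 = a ^ 4 * h ^ 2 * (√3 ^ 2) / 4 by ring, h3]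
    nlinarith
  exact (pow_le_pow_iff_left₀ hV0 (by norm_num) two_ne_zero).1 hsq

/-- ★★ THE BARLOW-IMAGE BALL COUNT: for `S` a Barlow image (window), `q ∈ S` and `R ≥ 9/5` there is a finite set of sites
`T ⊆ S ∩ B̄(q, R)` with `(4π/3)(R − 9/5)³ ≤ 1.036 · #T`. -/
theorem IsBarlowImage.exists_finset_closedBall {S : Set E3} (hS : IsBarlowImage S) {q : E3} (hq : q ∈ S) {R : ℝ} (hR : 9 / 5 ≤ R) :
    ∃ T : Finset E3, ↑T ⊆ S ∩ Metric.closedBall q R ∧ 4 * Real.pi / 3 * (R - 9 / 5) ^ 3 ≤ (T.card : ℝ) * (1036 / 1000) := by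
  obtain ⟨a, h, s, g, ha, hh, _, hg, rfl⟩ := hS
  obtain ⟨x₀, hx₀, rfl⟩ := hq
  have ha0 : 0 < a := by linarith [ha.1]
  obtain ⟨I, hI⟩ := exists_index_finset a h s ha0 hh.1 x₀ R
  let bp : ℤ × ℤ × ℤ → E3 := fun t => barlowPos a h s t.1 t.2.1 t.2.2
  have hinj : Function.Injective (g ∘ bp) := hg.injective.comp (barlowPos_triple_injective ha0 hh.1)
  refine ⟨I.image (g ∘ bp), ?_, ?_⟩
  · intro p hp
    obtain ⟨t, ht, rfl⟩ := Finset.mem_image.1 (Finset.mem_coe.1 hp)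
    refine ⟨⟨bp t, ⟨t.1, t.2.1, t.2.2, rfl⟩, rfl⟩, ?_⟩
    rw [Metric.mem_closedBall, Function.comp_apply, hg.dist_eq]
    exact (hI t).1 ht
  · rw [Finset.card_image_of_injective _ hinj]
    have hvol := ball_volume_le_card_mul a h s ha0 hh.1 (by norm_num) (window_brick_diag ha hh) x₀ hR I (fun t ht => (hI t).2 ht)
    exact hvol.trans (mul_le_mul_of_nonneg_left (window_cell_volume ha hh) (Nat.cast_nonneg _))

/-- RECORD COUNT at `R = 18`: at least `17 000` sites (the shape of part 3's `BarlowBallCount 18 17000`; `(4π/3)·16.2³/1.036 ≥ 17 181`). -/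
theorem barlow_ball_count_18 : ∀ S : Set E3, IsBarlowImage S → ∀ q ∈ S,
    ∃ T : Finset E3, ↑T ⊆ S ∩ Metric.closedBall q 18 ∧ 17000 ≤ T.card := by
  intro S hS q hq
  obtain ⟨T, hT, hvol⟩ := hS.exists_finset_closedBall hq (by norm_num : (9 / 5 : ℝ) ≤ 18)
  refine ⟨T, hT, ?_⟩
  have : (17000 : ℝ) ≤ T.card := by nlinarith [Real.pi_gt_d2]
  exact_mod_cast this

/-- RECORD COUNT at `R = 19`: at least `20 000` sites (`(4π/3)·17.2³/1.036 ≥ 20 563`). -/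
theorem barlow_ball_count_19 : ∀ S : Set E3, IsBarlowImage S → ∀ q ∈ S,
    ∃ T : Finset E3, ↑T ⊆ S ∩ Metric.closedBall q 19 ∧ 20000 ≤ T.card := by
  intro S hS q hq
  obtain ⟨T, hT, hvol⟩ := hS.exists_finset_closedBall hq (by norm_num : (9 / 5 : ℝ) ≤ 19)
  refine ⟨T, hT, ?_⟩
  have : (20000 : ℝ) ≤ T.card := by nlinarith [Real.pi_gt_d2]
  exact_mod_cast this

/-- RECORD COUNT at `R = 30`: at least `90 000` sites (`(4π/3)·28.2³/1.036 ≥ 90 627`). -/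
theorem barlow_ball_count_30 : ∀ S : Set E3, IsBarlowImage S → ∀ q ∈ S,
    ∃ T : Finset E3, ↑T ⊆ S ∩ Metric.closedBall q 30 ∧ 90000 ≤ T.card := by
  intro S hS q hq
  obtain ⟨T, hT, hvol⟩ := hS.exists_finset_closedBall hq (by norm_num : (9 / 5 : ℝ) ≤ 30)
  refine ⟨T, hT, ?_⟩
  have : (90000 : ℝ) ≤ T.card := by nlinarith [Real.pi_gt_d2]
  exact_mod_cast this

end CellCount

end Summit.AtomisticToContinuum.Crystallization.Theorems.ChargedEnergyGapChartDial

end
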